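import Literature.LinearAlgebra.GMSPermanentalRankSubspace
import Literature.Combinatorics.Optimization.KonigLineCover
import HarnessLib

/-!
# Guterman–Meshulam–Spiridonov 2023, Corollary 1.6 — PROVED: a linear space of `n × n` matrices
# over any field in which every matrix has permanental rank `≤ k` has dimension `≤ k·n`

[topic LinearAlgebra]

This file DISCHARGES the named fact `Literature.LinearAlgebra.GutermanMeshulamSpiridonov2023_cor_1_6`
of `GMSPermanentalRankSubspace.lean` (typed there verbatim from the held text
`paper:arxiv-2212.11193`, p0003 L94–97):
`theorem GutermanMeshulamSpiridonov2023_cor_1_6_holds : ∀ (F) [Field F],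
GutermanMeshulamSpiridonov2023_cor_1_6 F` (closed form; use as `…_holds F`).  No definition, no
new named fact; the permanental rank is the tree's `BoraleviCarliniMichalekVentura2025.prk` /
`rsubperm`, Kőnig's theorem is the tree's `KonigLineCover.exists_isScattered_isLineCover_card_eq`
(Brualdi–Ryser Thm. 1.2.1, proved there from Egerváry duality).

## The printed proof and how it is followed (arXiv:2212.11193, §2, p0005 L35–126)

A. E. Guterman, R. Meshulam, I. A. Spiridonov, *Maximal generalized rank in graphical matrix
spaces*, Israel J. Math. (2023) = arXiv:2212.11193.  Corollary 1.6 is Theorem 1.5 for `𝒷 = [n]²`,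
`ω ≡ 1` plus Remark 1.3 (Kőnig: `max {|𝒷'| : ν_b(𝒷') ≤ k} = kn`).  The proof of Theorem 1.5
(`≤` direction, p0005 L124–126) has three steps, mirrored here lemma by lemma:

1. p0005 L35–36: «for `0 ≠ A` let `q(A) = min_≺ {(i,j) : A(i,j) ≠ 0}` (lexicographic order) …
   `𝔟(W) = {q(A) : A ∈ W}` … `|𝔟(W)| = dim W`.»  We need only `dim W ≤ |𝔟(W)|`: a nonzero `A ∈ W`
   has a nonzero entry inside `𝔟(W)` (at `q(A)`), so restriction to the `𝔟(W)`-coordinates is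
   injective on `W` — `finrank_le_card_of_forall_exists_ne_zero`.
2. Proposition 2.2 (p0005 L39–120), «`ρ_ω(W) ≥ ν_b(𝔟(W))`»: a bipartite matching (= scattered set,
   the tree's `KonigLineCover.IsScattered`) `T ⊆ 𝔟(W)` yields `A ∈ W` with `prk A ≥ #T` —
   `card_le_prk_of_isScattered`.  As printed: pick `A_t ∈ W` with `q(A_t) = t`, rescale to
   `A_t(t) = 1`; expand the `I × J` permanent of `∑_t λ_t A_t` (`I`, `J` = rows, columns of `T`)
   multilinearly (`rsubperm_sum_expand`); the coefficient of the top monomial `∏_t λ_t` is the sum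
   over the maps `x : J → T` ONTO `T` and bijections `f : J → I` of `∏_c A_{x c}(f c, c)`, and the
   lexicographic minimality («`C_t(α,β) = 0` for `α < t` or (`α = t` & `β < π⁻¹(t)`)», (2.3)) kills
   every term but the one with `x c` = the member of `T` in column `c`, `f c` = its row, whose
   product is `1` (Claim 2.4's «the coefficient of `x_1 ⋯ x_k` in `g(x)` is `ω(π⁻¹) ≠ 0`», here
   `sum_onto_prod_eq_one`; the printed «`σ(ℓ) ≥ π⁻¹(ℓ)` for all `ℓ` forces `σ = π⁻¹`» is done as:
   two bijections onto the same finite set of naturals that compare pointwise are equal — equal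
   sums).
   DEVIATION (shorter road, same content): the paper then invokes Alon's Combinatorial
   Nullstellensatz (its Thm. 2.5) with `d_t = 1`, `Λ_t = {0,1}`.  Mathlib has it
   (`MvPolynomial.combinatorial_nullstellensatz_exists_eval_nonzero`), but for degrees `1` and the
   box `{0,1}^k` the Nullstellensatz IS the identity «the alternating sum `∑_{S ⊆ T} (-1)^{#S} g(𝟙_S)`
   equals `(-1)^{#T}` × (coefficient of `∏_t x_t`)», which we prove directly for our `g`
   (`alternating_sum_expand` + `sum_powerset_filter_superset_neg_one_pow`, from Mathlib's binomial
   identity `Finset.sum_pow_mul_eq_add_pow`), avoiding the `MvPolynomial`/`totalDegree` detour: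
   `exists_subset_rsubperm_sum_ne_zero` gives `λ ∈ {0,1}^T` (a subset `S ⊆ T`) with the `I × J`
   subpermanent of `∑_{t ∈ S} A_t ∈ W` nonzero, whence `prk ≥ #T` by the tree's
   `le_prk_of_rsubperm_ne_zero`.
3. Remark 1.3 / p0005 L124–126: with `prk ≤ k` on `W`, every scattered `T ⊆ 𝔟(W)` has `#T ≤ k`;
   Kőnig's theorem gives a cover of `𝔟(W)` by `#T ≤ k` lines, each of `n` positions, so
   `dim W ≤ |𝔟(W)| ≤ k·n` — `GutermanMeshulamSpiridonov2023_cor_1_6_holds`.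

WHAT THIS IS NOT: Theorem 1.5 in its generality (graphical spaces `M_𝒷(𝔽)`, general weights `ω`),
the equality `|𝔟(W)| = dim W`, and the equality cases (Thm. 1.7) are not formalized; nothing here
bears on `VP ≠ VNP` beyond feeding the consumer stub `stub_gms : GMSBound` (val-idea-9,
`stmt-ValiantsHypothesis-24318`) through its own bridge `gmsBound_of_fact`.

## References

* [GutermanMeshulamSpiridonov2023] A. E. Guterman, R. Meshulam, I. A. Spiridonov, *Maximal
  generalized rank in graphical matrix spaces*, Israel J. Math. (2023),
  doi:10.1007/s11856-023-2508-6, arXiv:2212.11193 — Cor. 1.6 (p0003 L94–97), Thm. 1.5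
  (p0003 L81–92), Remark 1.3 (p0003 L52–56), §2: `q(A)`, `𝔟(W)` (p0005 L35–36), Prop. 2.2 and
  Claim 2.4 (p0005 L39–120), proof of Thm. 1.5 (p0005 L122–126).
* [Alon99] N. Alon, *Combinatorial Nullstellensatz*, Combin. Probab. Comput. 8 (1999) 7–29,
  Thm. 1.2 — replaced here by the alternating-sum identity for multilinear top coefficients.
* [BrualdiRyser1991] R. A. Brualdi, H. J. Ryser, *Combinatorial Matrix Theory*, Thm. 1.2.1
  (Kőnig) — the tree's `KonigLineCover`.
-/

noncomputable section

namespace Literature.LinearAlgebra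

namespace GutermanMeshulamSpiridonov2023

open Module Matrix Finset
open Literature.Computability.AlgebraicComplexity.BoraleviCarliniMichalekVentura2025
  (prk rsubperm le_prk_of_rsubperm_ne_zero)
open Literature.Combinatorics.Optimization.KonigLineCover
  (IsScattered IsLineCover exists_isScattered_isLineCover_card_eq)

variable {F : Type*} [Field F] {n : ℕ}

/-- **Step 1** («Note that if `W ≤ M_n(𝔽)` is a linear subspace then `|𝔟(W)| = dim W`», the half
we need): if every nonzero matrix of `W` has a nonzero entry at a position of `B`, then
`dim W ≤ #B` — restriction to the `B`-coordinates is an injective linear map `W → F^B`.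
[cite: GutermanMeshulamSpiridonov2023, §2 (arXiv:2212.11193 p0005 L35–36)] -/
theorem finrank_le_card_of_forall_exists_ne_zero (W : Submodule F (Matrix (Fin n) (Fin n) F))
    (B : Finset (Fin n × Fin n)) (hB : ∀ A ∈ W, A ≠ 0 → ∃ p ∈ B, A p.1 p.2 ≠ 0) :
    finrank F W ≤ #B := by
  let φ : W →ₗ[F] ({p // p ∈ B} → F) :=
    { toFun := fun A p => (A : Matrix (Fin n) (Fin n) F) p.1.1 p.1.2
      map_add' := fun A A' => by ext p; simp
      map_smul' := fun c A => by ext p; simp }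
  have hφ : Function.Injective φ := by
    rw [← LinearMap.ker_eq_bot, LinearMap.ker_eq_bot']
    intro A hA
    by_contra hne
    have hne' : (A : Matrix (Fin n) (Fin n) F) ≠ 0 := by
      intro h; exact hne (Subtype.ext h)
    obtain ⟨p, hpB, hp⟩ := hB A A.2 hne'
    exact hp (by simpa [φ] using congr_fun hA ⟨p, hpB⟩)
  calc finrank F W ≤ finrank F ({p // p ∈ B} → F) :=
        LinearMap.finrank_le_finrank_of_injective hφ
    _ = #B := by rw [Module.finrank_fintype_fun_eq_card, Fintype.card_coe]

/-- Multilinear expansion of a subpermanent of `∑_{t ∈ S} A_t` («`g(x) = D_ω(G(x)) =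
∑_σ ω(σ) ∏_ℓ G(x)(ℓ, σ(ℓ))`» with `G(x) = ∑_t x_t C_t`, at `x = 𝟙_S`):
`per((∑_{t ∈ S} A_t)[I|J]) = ∑_f ∑_{x : J → S} ∏_c A_{x c}(f c, c)`.
[cite: GutermanMeshulamSpiridonov2023, proof of Prop. 2.2 (arXiv:2212.11193 p0005 L71–77)] -/
theorem rsubperm_sum_expand (A : Fin n × Fin n → Matrix (Fin n) (Fin n) F)
    (S : Finset (Fin n × Fin n)) (I J : Finset (Fin n)) :
    rsubperm (∑ t ∈ S, A t) (· ∈ J) (· ∈ I) =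
      ∑ f : {c // c ∈ J} ≃ {r // r ∈ I},
        ∑ x ∈ Fintype.piFinset (fun _ : {c // c ∈ J} => S), ∏ c, A (x c) (f c) c := by
  unfold rsubperm
  simp only [Matrix.sum_apply, Finset.prod_univ_sum]
  convert rfl

/-- The inner alternating sum (inclusion–exclusion): for `R ⊆ T`, `∑_{R ⊆ S ⊆ T} (-1)^{#S}` is
`(-1)^{#T}` if `R = T` and `0` otherwise (`= (-1)^{#R} (1 - 1)^{#(T ∖ R)}`, Mathlib's
`Finset.sum_pow_mul_eq_add_pow`). [folklore] -/
private theorem sum_powerset_filter_superset_neg_one_pow (T R : Finset (Fin n × Fin n)) (hRT : R ⊆ T) :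
    ∑ S ∈ T.powerset with R ⊆ S, (-1 : F) ^ #S = if R = T then (-1 : F) ^ #T else 0 := by
  classical
  have hbij : ∑ S ∈ T.powerset with R ⊆ S, (-1 : F) ^ #S =
      ∑ U ∈ (T \ R).powerset, (-1 : F) ^ #(R ∪ U) := by
    refine Finset.sum_nbij' (fun S => S \ R) (fun U => R ∪ U) ?_ ?_ ?_ ?_ ?_
    · intro S hS
      simp only [Finset.mem_filter, Finset.mem_powerset] at hS
      exact Finset.mem_powerset.2 (Finset.sdiff_subset_sdiff hS.1 le_rfl)
    · intro U hU
      have hU := Finset.mem_powerset.1 hU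
      simp only [Finset.mem_filter, Finset.mem_powerset]
      refine ⟨Finset.union_subset hRT (hU.trans Finset.sdiff_subset), Finset.subset_union_left⟩
    · intro S hS
      simp only [Finset.mem_filter, Finset.mem_powerset] at hS
      exact Finset.union_sdiff_of_subset hS.2
    · intro U hU
      have hU := Finset.mem_powerset.1 hU
      rw [Finset.union_sdiff_left]
      exact Finset.sdiff_eq_self_of_disjoint
        (Finset.disjoint_of_subset_left hU disjoint_sdiff_self_left)
    · intro S hS
      simp only [Finset.mem_filter, Finset.mem_powerset] at hS
      rw [Finset.union_sdiff_of_subset hS.2]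
  rw [hbij]
  have hdisj : ∀ U ∈ (T \ R).powerset, #(R ∪ U) = #R + #U := fun U hU =>
    Finset.card_union_of_disjoint
      (Finset.disjoint_of_subset_right (Finset.mem_powerset.1 hU) disjoint_sdiff_self_right)
  rw [Finset.sum_congr rfl fun U hU => by rw [hdisj U hU, pow_add]]
  rw [← Finset.mul_sum]
  have h01 : ∑ U ∈ (T \ R).powerset, (-1 : F) ^ #U = (-1 + 1) ^ #(T \ R) := by
    rw [← Finset.sum_pow_mul_eq_add_pow]
    exact Finset.sum_congr rfl fun U _ => by rw [one_pow, mul_one]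
  rw [h01, neg_add_cancel]
  by_cases hR : R = T
  · subst hR; simp
  · have hne : (T \ R).Nonempty := by
      rw [Finset.sdiff_nonempty]; intro hTR; exact hR (Finset.Subset.antisymm hRT hTR)
    rw [if_neg hR, zero_pow (Finset.card_pos.2 hne).ne', mul_zero]

/-- **The Nullstellensatz step for `d_t = 1`, `Λ_t = {0,1}`, done by hand**: swapping the
alternating sum over `S ⊆ T` with a multilinear expansion `∑_{x : ι → S} g x`, only the maps
`x : ι → T` that are ONTO `T` survive, each with the sign `(-1)^{#T}` — i.e. the alternating sum
of the values on `{0,1}^T` is `±` the coefficient of the top monomial `∏_{t ∈ T} x_t`.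
[cite: GutermanMeshulamSpiridonov2023, Thm. 2.5 = Alon 1999 Thm. 1.2, as applied with `d_t = 1`, `Λ_t = {0,1}` (arXiv:2212.11193 p0005 L84–92, L116–118)] -/
theorem alternating_sum_expand (T : Finset (Fin n × Fin n)) {ι : Type*} [Fintype ι]
    [DecidableEq ι] (g : (ι → Fin n × Fin n) → F) :
    ∑ S ∈ T.powerset, (-1 : F) ^ #S * ∑ x ∈ Fintype.piFinset (fun _ : ι => S), g x =
      (-1 : F) ^ #T *
        ∑ x ∈ (Fintype.piFinset fun _ : ι => T) with univ.image x = T, g x := by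
  classical
  -- rewrite the inner domain as a filter of `piFinset T`
  have hdom : ∀ S ∈ T.powerset, Fintype.piFinset (fun _ : ι => S) =
      (Fintype.piFinset fun _ : ι => T).filter (fun x => univ.image x ⊆ S) := by
    intro S hS
    have hST := Finset.mem_powerset.1 hS
    ext x
    simp only [Fintype.mem_piFinset, Finset.mem_filter, Finset.image_subset_iff, Finset.mem_univ,
      true_implies]
    exact ⟨fun h => ⟨fun a => hST (h a), h⟩, fun h => h.2⟩
  rw [Finset.sum_congr rfl fun S hS => by rw [hdom S hS, Finset.sum_filter, Finset.mul_sum],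
    Finset.sum_comm]
  -- collect the sign for each `x`
  have hx : ∀ x ∈ Fintype.piFinset (fun _ : ι => T),
      ∑ S ∈ T.powerset, (-1 : F) ^ #S * (if univ.image x ⊆ S then g x else 0) =
        (if univ.image x = T then (-1 : F) ^ #T else 0) * g x := by
    intro x hxT
    have hRT : univ.image x ⊆ T := by
      rw [Finset.image_subset_iff]; exact fun a _ => Fintype.mem_piFinset.1 hxT a
    rw [← sum_powerset_filter_superset_neg_one_pow T (univ.image x) hRT, Finset.sum_filter,
      Finset.sum_mul]
    refine Finset.sum_congr rfl fun S _ => ?_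
    split_ifs <;> simp
  rw [Finset.sum_congr rfl hx, Finset.sum_filter, Finset.mul_sum]
  refine Finset.sum_congr rfl fun x _ => ?_
  split_ifs <;> simp

/-- **The top coefficient is `1`** (the heart of the proof of Prop. 2.2, «if `γ(σ) ≠ 0` then
`σ(ℓ) ≥ π⁻¹(ℓ)` for all `ℓ`, i.e. `σ = π⁻¹`»): among the pairs `(f, x)` — `f` a bijection from the
columns `J` of the scattered set `T` to its rows `I`, `x : J → T` onto `T` — exactly one has all
its factors `A_{x c}(f c, c)` nonzero, namely `x c =` the member of `T` in column `c` and
`f c =` its row, and that product is `1`; all other products vanish by the lexicographic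
minimality of the positions `t` among the nonzero entries of `A_t`.
[cite: GutermanMeshulamSpiridonov2023, Claim 2.4, proof (arXiv:2212.11193 p0005 L94–114) with (2.3) (p0005 L59–69)] -/
theorem sum_onto_prod_eq_one (T : Finset (Fin n × Fin n)) (hT : IsScattered T)
    (A : Fin n × Fin n → Matrix (Fin n) (Fin n) F) (h1 : ∀ t ∈ T, A t t.1 t.2 = 1)
    (h0 : ∀ t ∈ T, ∀ i j, A t i j ≠ 0 → t.1 ≤ i ∧ (t.1 = i → t.2 ≤ j)) :
    ∑ f : {c // c ∈ T.image Prod.snd} ≃ {r // r ∈ T.image Prod.fst},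
      ∑ x ∈ (Fintype.piFinset fun _ : {c // c ∈ T.image Prod.snd} => T) with univ.image x = T,
        ∏ c, A (x c) (f c) c = 1 := by
  classical
  set I := T.image Prod.fst with hI
  set J := T.image Prod.snd with hJ
  have hfst : Set.InjOn Prod.fst (T : Set (Fin n × Fin n)) :=
    fun p hp q hq h => hT.1 p hp q hq h
  have hsnd : Set.InjOn Prod.snd (T : Set (Fin n × Fin n)) :=
    fun p hp q hq h => hT.2 p hp q hq h
  have hJcard : #J = #T := Finset.card_image_of_injOn hsnd
  -- the member of `T` in column `c`
  have hcol : ∀ c : {c // c ∈ J}, ∃! t, t ∈ T ∧ t.2 = (c : Fin n) := by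
    intro c
    obtain ⟨t, htT, htc⟩ := Finset.mem_image.1 c.2
    exact ⟨t, ⟨htT, htc⟩, fun t' ht' => hT.2 t' ht'.1 t htT (ht'.2.trans htc.symm)⟩
  let x₀ : {c // c ∈ J} → Fin n × Fin n :=
    fun c => T.choose (fun t => t.2 = (c : Fin n)) (hcol c)
  have hx₀T : ∀ c, x₀ c ∈ T := fun c => Finset.choose_mem _ _ _
  have hx₀c : ∀ c : {c // c ∈ J}, (x₀ c).2 = (c : Fin n) :=
    fun c => Finset.choose_property _ _ (hcol c)
  have hx₀uniq : ∀ c : {c // c ∈ J}, ∀ t ∈ T, t.2 = (c : Fin n) → t = x₀ c :=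
    fun c t ht htc => hT.2 t ht (x₀ c) (hx₀T c) (htc.trans (hx₀c c).symm)
  -- its row, as a bijection `J ≃ I`
  let g₀ : {c // c ∈ J} → {r // r ∈ I} :=
    fun c => ⟨(x₀ c).1, Finset.mem_image_of_mem _ (hx₀T c)⟩
  have hg₀ : Function.Bijective g₀ := by
    constructor
    · intro c c' h
      have h1' : (x₀ c).1 = (x₀ c').1 := congrArg Subtype.val h
      have h2 := hT.1 (x₀ c) (hx₀T c) (x₀ c') (hx₀T c') h1'
      apply Subtype.ext
      rw [← hx₀c c, ← hx₀c c', h2]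
    · intro r
      obtain ⟨t, htT, htr⟩ := Finset.mem_image.1 r.2
      refine ⟨⟨t.2, Finset.mem_image_of_mem _ htT⟩, Subtype.ext ?_⟩
      show (x₀ ⟨t.2, _⟩).1 = r
      rw [← hx₀uniq ⟨t.2, Finset.mem_image_of_mem _ htT⟩ t htT rfl]
      exact htr
  let f₀ : {c // c ∈ J} ≃ {r // r ∈ I} := Equiv.ofBijective g₀ hg₀
  have hf₀ : ∀ c, ((f₀ c : {r // r ∈ I}) : Fin n) = (x₀ c).1 := fun c => rfl
  -- `x₀` is one of the onto maps
  have hx₀mem : x₀ ∈ (Fintype.piFinset fun _ : {c // c ∈ J} => T).filter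
      (fun x => univ.image x = T) := by
    rw [Finset.mem_filter, Fintype.mem_piFinset]
    refine ⟨hx₀T, Finset.Subset.antisymm ?_ ?_⟩
    · rw [Finset.image_subset_iff]; exact fun c _ => hx₀T c
    · intro t ht
      exact Finset.mem_image.2
        ⟨⟨t.2, Finset.mem_image_of_mem _ ht⟩, Finset.mem_univ _,
          (hx₀uniq _ t ht rfl).symm⟩
  -- uniqueness: a pair all of whose factors are nonzero is `(f₀, x₀)`
  have huniq : ∀ (f : {c // c ∈ J} ≃ {r // r ∈ I}) (x : {c // c ∈ J} → Fin n × Fin n),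
      x ∈ (Fintype.piFinset fun _ : {c // c ∈ J} => T).filter (fun x => univ.image x = T) →
      (∀ c, A (x c) (f c) c ≠ 0) → x = x₀ ∧ f = f₀ := by
    intro f x hx hne
    rw [Finset.mem_filter, Fintype.mem_piFinset] at hx
    obtain ⟨hxT, hxim⟩ := hx
    have hle : ∀ c, (x c).1 ≤ (f c : Fin n) ∧ ((x c).1 = f c → (x c).2 ≤ (c : Fin n)) :=
      fun c => h0 (x c) (hxT c) _ _ (hne c)
    -- `x` is injective, by counting
    have hxinj : Set.InjOn x ↑(univ : Finset {c // c ∈ J}) := by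
      rw [← Finset.card_image_iff, hxim, Finset.card_univ, Fintype.card_coe, hJcard]
    -- rows: `∑_c row (x c) = ∑_{t ∈ T} row t = ∑_{r ∈ I} r = ∑_c f c`, `row (x c) ≤ f c`
    have hrowsum : ∑ c, ((x c).1 : ℕ) = ∑ c, (((f c : {r // r ∈ I}) : Fin n) : ℕ) := by
      have e1 : ∑ c, ((x c).1 : ℕ) = ∑ t ∈ T, ((t.1 : Fin n) : ℕ) := by
        rw [← hxim, Finset.sum_image hxinj]
      have e2 : ∑ r ∈ I, ((r : Fin n) : ℕ) = ∑ t ∈ T, ((t.1 : Fin n) : ℕ) := by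
        rw [hI, Finset.sum_image hfst]
      have e3 : ∑ c, (((f c : {r // r ∈ I}) : Fin n) : ℕ) = ∑ r ∈ I, ((r : Fin n) : ℕ) := by
        rw [Equiv.sum_comp f (fun r : {r // r ∈ I} => ((r : Fin n) : ℕ)),
          Finset.sum_coe_sort]
      rw [e1, e3, e2]
    have hrow : ∀ c, (x c).1 = (f c : Fin n) := by
      have h := (Finset.sum_eq_sum_iff_of_le (s := (univ : Finset {c // c ∈ J}))
        (f := fun c => ((x c).1 : ℕ)) (g := fun c => (((f c : {r // r ∈ I}) : Fin n) : ℕ))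
        (fun c _ => (hle c).1)).1 hrowsum
      intro c
      exact Fin.ext (h c (Finset.mem_univ c))
    -- columns: `∑_c col (x c) = ∑_{t ∈ T} col t = ∑_{j ∈ J} j = ∑_c c`, `col (x c) ≤ c`
    have hcolsum : ∑ c, ((x c).2 : ℕ) = ∑ c : {c // c ∈ J}, ((c : Fin n) : ℕ) := by
      have e1 : ∑ c, ((x c).2 : ℕ) = ∑ t ∈ T, ((t.2 : Fin n) : ℕ) := by
        rw [← hxim, Finset.sum_image hxinj]
      have e2 : ∑ j ∈ J, ((j : Fin n) : ℕ) = ∑ t ∈ T, ((t.2 : Fin n) : ℕ) := by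
        rw [hJ, Finset.sum_image hsnd]
      have e3 : ∑ c : {c // c ∈ J}, ((c : Fin n) : ℕ) = ∑ j ∈ J, ((j : Fin n) : ℕ) :=
        Finset.sum_coe_sort J (fun j => ((j : Fin n) : ℕ))
      rw [e1, e3, e2]
    have hcolle : ∀ c, (x c).2 ≤ (c : Fin n) := fun c => (hle c).2 (hrow c)
    have hcoleq : ∀ c, (x c).2 = (c : Fin n) := by
      have h := (Finset.sum_eq_sum_iff_of_le (s := (univ : Finset {c // c ∈ J}))
        (f := fun c => ((x c).2 : ℕ)) (g := fun c => ((c : Fin n) : ℕ))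
        (fun c _ => hcolle c)).1 hcolsum
      intro c
      exact Fin.ext (h c (Finset.mem_univ c))
    have hxx₀ : x = x₀ := funext fun c => hx₀uniq c (x c) (hxT c) (hcoleq c)
    refine ⟨hxx₀, Equiv.ext fun c => Subtype.ext ?_⟩
    rw [hf₀, ← hrow c, hxx₀]
  -- evaluate the double sum at the single surviving pair
  rw [Finset.sum_eq_single_of_mem f₀ (Finset.mem_univ _)]
  · rw [Finset.sum_eq_single_of_mem x₀ hx₀mem]
    · refine Finset.prod_eq_one fun c _ => ?_
      have h := h1 (x₀ c) (hx₀T c)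
      rw [hx₀c c] at h
      rw [hf₀]
      exact h
    · intro x hx hxne
      by_contra hprod
      have hall : ∀ c, A (x c) (f₀ c) c ≠ 0 :=
        fun c h => hprod (Finset.prod_eq_zero (Finset.mem_univ c) h)
      exact hxne (huniq f₀ x hx hall).1
  · intro f _ hfne
    refine Finset.sum_eq_zero fun x hx => ?_
    by_contra hprod
    have hall : ∀ c, A (x c) (f c) c ≠ 0 :=
      fun c h => hprod (Finset.prod_eq_zero (Finset.mem_univ c) h)
    exact hfne (huniq f x hx hall).2

/-- **Claim 2.4 for `ω ≡ 1`, with `λ ∈ {0,1}^k`** («there exists `λ ∈ {0,1}^k` such that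
`D_ω(G(λ)) = g(λ) ≠ 0`»): for a scattered `T` and matrices `A_t` (`t ∈ T`) with `A_t(t) = 1` and
`A_t(i,j) = 0` at every position `(i,j)` lexicographically before `t`, some SUBSET `S ⊆ T` makes the
`I × J` subpermanent of `∑_{t ∈ S} A_t` nonzero (`I`, `J` = the rows, columns of `T`).  Proof: the
alternating sum of these subpermanents over all `S ⊆ T` is `(-1)^{#T}` times the top coefficient,
which is `1`. [cite: GutermanMeshulamSpiridonov2023, Claim 2.4 (arXiv:2212.11193 p0005 L79–82, L116–120)] -/
theorem exists_subset_rsubperm_sum_ne_zero (T : Finset (Fin n × Fin n)) (hT : IsScattered T)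
    (A : Fin n × Fin n → Matrix (Fin n) (Fin n) F) (h1 : ∀ t ∈ T, A t t.1 t.2 = 1)
    (h0 : ∀ t ∈ T, ∀ i j, A t i j ≠ 0 → t.1 ≤ i ∧ (t.1 = i → t.2 ≤ j)) :
    ∃ S ⊆ T,
      rsubperm (∑ t ∈ S, A t) (· ∈ T.image Prod.snd) (· ∈ T.image Prod.fst) ≠ 0 := by
  classical
  by_contra hall
  push Not at hall
  have hval : ∑ S ∈ T.powerset, (-1 : F) ^ #S *
      rsubperm (∑ t ∈ S, A t) (· ∈ T.image Prod.snd) (· ∈ T.image Prod.fst) =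
        (-1 : F) ^ #T := by
    simp_rw [rsubperm_sum_expand]
    rw [Finset.sum_congr rfl fun S _ => Finset.mul_sum _ _ _, Finset.sum_comm]
    simp_rw [alternating_sum_expand T]
    rw [← Finset.mul_sum, sum_onto_prod_eq_one T hT A h1 h0, mul_one]
  have hzero : ∑ S ∈ T.powerset, (-1 : F) ^ #S *
      rsubperm (∑ t ∈ S, A t) (· ∈ T.image Prod.snd) (· ∈ T.image Prod.fst) = 0 :=
    Finset.sum_eq_zero fun S hS => by rw [hall S (Finset.mem_powerset.1 hS), mul_zero]
  rw [hval] at hzero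
  exact pow_ne_zero _ (neg_ne_zero.2 (one_ne_zero' F)) hzero

/-- **Proposition 2.2 for `ω ≡ 1`** («`ρ_ω(W) ≥ ν_b(𝔟(W))`», the form we use): if `T` is a
scattered set of positions and for every `t ∈ T` the space `W` contains a matrix whose
lexicographically least nonzero entry sits at `t`, then `W` contains a matrix of permanental rank
`≥ #T`. [cite: GutermanMeshulamSpiridonov2023, Prop. 2.2 and Claim 2.4 (arXiv:2212.11193 p0005 L39–120)] -/
theorem card_le_prk_of_isScattered (W : Submodule F (Matrix (Fin n) (Fin n) F))
    (T : Finset (Fin n × Fin n)) (hT : IsScattered T)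
    (hlead : ∀ t ∈ T, ∃ A ∈ W, A t.1 t.2 ≠ 0 ∧
      ∀ i j, A i j ≠ 0 → t.1 ≤ i ∧ (t.1 = i → t.2 ≤ j)) :
    ∃ A ∈ W, #T ≤ prk A := by
  classical
  -- rescale so that `A_t(t) = 1`
  have hlead' : ∀ t ∈ T, ∃ A ∈ W, A t.1 t.2 = 1 ∧
      ∀ i j, A i j ≠ 0 → t.1 ≤ i ∧ (t.1 = i → t.2 ≤ j) := by
    intro t ht
    obtain ⟨A, hAW, hAt, hA0⟩ := hlead t ht
    refine ⟨(A t.1 t.2)⁻¹ • A, W.smul_mem _ hAW, by simp [hAt], fun i j hij => hA0 i j ?_⟩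
    intro h
    exact hij (by simp [h])
  choose! A hAW hA1 hA0 using hlead'
  obtain ⟨S, hST, hne⟩ := exists_subset_rsubperm_sum_ne_zero T hT A hA1 hA0
  refine ⟨∑ t ∈ S, A t, W.sum_mem fun t ht => hAW t (hST ht), ?_⟩
  have hfst : Set.InjOn Prod.fst (T : Set (Fin n × Fin n)) :=
    fun p hp q hq h => hT.1 p hp q hq h
  have hsnd : Set.InjOn Prod.snd (T : Set (Fin n × Fin n)) :=
    fun p hp q hq h => hT.2 p hp q hq h
  exact le_prk_of_rsubperm_ne_zero _ (Finset.card_image_of_injOn hfst)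
    (Finset.card_image_of_injOn hsnd) hne

end GutermanMeshulamSpiridonov2023

open Module Finset
open Literature.Computability.AlgebraicComplexity.BoraleviCarliniMichalekVentura2025 (prk)
open Literature.Combinatorics.Optimization.KonigLineCover
  (IsScattered IsLineCover exists_isScattered_isLineCover_card_eq)
open GutermanMeshulamSpiridonov2023

/-- **Guterman–Meshulam–Spiridonov 2023, Corollary 1.6 — PROVED**: over any field `F`, a linear
subspace `W ≤ M_n(F)` all of whose members have permanental rank `≤ k` has `dim W ≤ k·n`.
Proof as printed (§2): `dim W ≤ |𝔟(W)|` for the set `𝔟(W)` of lexicographically least nonzero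
positions (`finrank_le_card_of_forall_exists_ne_zero`); a scattered `T ⊆ 𝔟(W)` has
`#T ≤ prk A ≤ k` for some `A ∈ W` (Prop. 2.2, `card_le_prk_of_isScattered`, the Nullstellensatz
step done as an alternating sum over `{0,1}^T`); Kőnig's theorem (the tree's
`KonigLineCover.exists_isScattered_isLineCover_card_eq`) covers `𝔟(W)` by `#T ≤ k` lines of `n`
positions each. [cite: GutermanMeshulamSpiridonov2023, Cor. 1.6 via Thm. 1.5, Prop. 2.2, Claim 2.4 and Remark 1.3 (arXiv:2212.11193 p0003 L52–56, L81–97; p0005 L35–126)] -/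
theorem GutermanMeshulamSpiridonov2023_cor_1_6_holds :
    ∀ (F : Type*) [Field F], GutermanMeshulamSpiridonov2023_cor_1_6 F := by
  intro F _ n k W hW
  classical
  -- `𝔟(W)`: the lexicographically least nonzero positions of the members of `W`
  set B : Finset (Fin n × Fin n) := univ.filter fun p => ∃ A ∈ W, A p.1 p.2 ≠ 0 ∧
    ∀ i j, A i j ≠ 0 → p.1 ≤ i ∧ (p.1 = i → p.2 ≤ j) with hBdef
  have hB : ∀ A ∈ W, A ≠ 0 → ∃ p ∈ B, A p.1 p.2 ≠ 0 := by
    intro A hAW hA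
    obtain ⟨i, j, hij⟩ : ∃ i j, A i j ≠ 0 := by
      by_contra h
      push Not at h
      exact hA (Matrix.ext fun i j => h i j)
    obtain ⟨p, hp, hmin⟩ := Finset.exists_min_image
      (univ.filter fun q : Fin n × Fin n => A q.1 q.2 ≠ 0) (fun q => toLex q)
      ⟨(i, j), by simpa using hij⟩
    have hp' : A p.1 p.2 ≠ 0 := (Finset.mem_filter.1 hp).2
    refine ⟨p, ?_, hp'⟩
    rw [hBdef, Finset.mem_filter]
    refine ⟨Finset.mem_univ _, A, hAW, hp', fun i' j' h' => ?_⟩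
    have := hmin (i', j') (by simpa using h')
    exact Prod.Lex.toLex_le_toLex'.1 this
  -- Kőnig: a largest scattered subset `T` of `𝔟(W)` and a line cover by `#T` lines
  obtain ⟨T, hTB, R, C, hT, hcover, hcard⟩ := exists_isScattered_isLineCover_card_eq B
  -- Prop. 2.2: `#T ≤ prk A ≤ k` for some `A ∈ W`
  have hTk : #T ≤ k := by
    have hlead : ∀ t ∈ T, ∃ A ∈ W, A t.1 t.2 ≠ 0 ∧
        ∀ i j, A i j ≠ 0 → t.1 ≤ i ∧ (t.1 = i → t.2 ≤ j) := by
      intro t ht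
      have := hTB ht
      rw [hBdef, Finset.mem_filter] at this
      exact this.2
    obtain ⟨A, hAW, hA⟩ := card_le_prk_of_isScattered W T hT hlead
    exact hA.trans (hW A hAW)
  -- the cover: `𝔟(W) ⊆ (R × [n]) ∪ ([n] × C)`
  have hBle : #B ≤ #R * n + n * #C := by
    calc #B ≤ #(R ×ˢ (univ : Finset (Fin n)) ∪ (univ : Finset (Fin n)) ×ˢ C) := by
          refine Finset.card_le_card fun p hp => ?_
          rcases hcover p hp with h | h
          · exact Finset.mem_union_left _ (Finset.mem_product.2 ⟨h, Finset.mem_univ _⟩)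
          · exact Finset.mem_union_right _ (Finset.mem_product.2 ⟨Finset.mem_univ _, h⟩)
      _ ≤ #(R ×ˢ (univ : Finset (Fin n))) + #((univ : Finset (Fin n)) ×ˢ C) :=
          Finset.card_union_le _ _
      _ = #R * n + n * #C := by
          rw [Finset.card_product, Finset.card_product, Finset.card_univ, Fintype.card_fin]
  calc finrank F W ≤ #B := finrank_le_card_of_forall_exists_ne_zero W B hB
    _ ≤ #R * n + n * #C := hBle
    _ = #T * n := by rw [hcard]; ring
    _ ≤ k * n := Nat.mul_le_mul_right n hTk


end Literature.LinearAlgebra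

end
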